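import Summits.ResolutionOfSingularities.ResolutionOfSingularities.Theses.FoliationDescent
import Summits.ResolutionOfSingularities.ResolutionOfSingularities.Theses.ShadowGame
import Summits.ResolutionOfSingularities.ResolutionOfSingularities.Theorems.SandwichedSingularitiesResolutionSlices
import Literature.AlgebraicGeometry.Resolution.ZariskiPatchingProperModels
import Literature.AlgebraicGeometry.Resolution.ProperModelsPatchingOfResolution
import HarnessLib

/-!
# Crux `PatchingRelPerfect` (stmt-ResolutionOfSingularities-16161) — birth skeleton (BC3), line `birth`

Route `ResolutionOfSingularities/FoliationDescent`, crux #6 (rank 6, difficulty open-problem), SHARED verbatim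
(same term, deduplicated by normalised signature) with routes `ShadowGame` (#4), `WildCones`, `FrobeniusClosing`,
`InertialGeneration`, `DefectlessFrames`, `JacobianBudget`:
`PatchingRelPerfect` = "for every prime `p`: if relative local uniformization holds for every finitely generated
`K/k` over every PERFECT field `k` of characteristic `p` (`RelLUPerfect p`), then every reduced separated scheme of
finite type over every PERFECT field of characteristic `p` has a resolution of singularities (`ResPerfect p`)" —
Zariski's patching of local uniformizations into one resolution (Zariski 1944, Fundamental Theorem p. 539;
Piltant 2013, Prop. 5.1 and Cor. 5.7 with `P = P_reg`; "All of these problems are open in dimension four or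
more", p. 2), restricted to perfect ground fields. It is FIBREWISE (one ground field `k` at a time) identical
to the all-fields crux `Valuative.PatchingRel` (stmt-0642), whose crux chain (line `sandwiched-gluing`, five
lead seats, `Cruxes/PatchingRel/LINE-STATUS.md`) formalised the entire Zariski–Piltant reduction in the tree and
died at the one residual atom (resolution over sandwiched-singularity opens in dimension `≥ 4`).

## The cut (two named stubs; Zariski's compactness step PROVED; `PatchingRelPerfect_of` proved)

Over ONE perfect field `k` of characteristic `p`, Zariski's programme is: (i) relative LU ⇒ every valuation of
`K/k` has a regular centre on some proper model; (ii) the Zariski–Riemann space is quasi-compact, so finitely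
many proper models form a resolving system; (iii) finitely many models patch to one regular model as soon as any
TWO proper models patch (`TwoModelPatchingPerfect p`, Piltant's Prop. 5.1 shape `φᵢ⁻¹(Reg Mᵢ) ⊆ Reg N`);
(iv) components + Chow + projective closure reduce arbitrary reduced separated finite-type `k`-schemes to integral
projective ones. Steps (i), (ii), (iv) and the iteration in (iii) are THEOREMS OF THE TREE, fibrewise over `k`
(`resolutionOverUpToDim_of_properPatching_of_relLU`, `ZariskiPatchingProperModels.lean`), so they are PROVED here
(`resPerfect_of_twoModelPatching_of_relLU`, with `[PerfectField k]` carried along) and are NOT stubs. Two-model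
patching itself is reduced — again fibrewise, Piltant 2013 proof of Prop. 5.1 — to ONE resolution-type input,
resolution of a variety OVER a sandwiched-singularity open (`SandwichedLocusPerfect p` = the tree's conjecture
`SandwichedLocusResolution p`, SANDᴸ, restricted to perfect ground fields). The two stubs are exactly:

* `stub_sandwichedOfLU` — **the atom (load-bearing; OPEN in dimension ≥ 4, TRUE in dimension ≤ 3 by
  Cossart–Piltant 2019).** `RelLUPerfect p → SandwichedLocusPerfect p`: with relative LU over perfect fields of
  characteristic `p` in hand, for `k` perfect of characteristic `p`, `U` a regular variety over `k`, `M` a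
  variety over `k`, opens `V ⊆ O ⊆ M` with `M` regular on `O ∖ V` and `V → U` proper birational, there is a
  proper birational integral `N → M` regular over `O`. No slack: `PatchingRelPerfect ⟺ ∀ p prime,
  (RelLUPerfect p → SandwichedLocusPerfect p)` (`⇐` is this skeleton; `⇒` is `sig_stub_sandwichedOfLU_of_crux`,
  proved below: a resolution of `M` is a resolution over every open), exactly as
  `patchingRel_iff_lurel_imp_sandwichedLocus` for the all-fields twin. Why it might fail: every sufficient
  condition on record for SANDᴸ in dimension `≥ 4` is itself a resolution theorem in dimension `≥ 4`
  (`Cruxes/PatchingRel/LINE-STATUS.md`, verdict); LU is consumed once (finite resolving system) and nobody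
  knows how to spend it on the sandwiched piece; perfectness of `k` (regular = smooth, residue fields of closed
  points perfect again) is the only extra structure this copy of the crux offers.
* `stub_patchingOfSandwiched` — **two-model patching from sandwiched resolution (TRUE on paper; Lean size M).**
  `SandwichedLocusPerfect p → TwoModelPatchingPerfect p`: for `φ : M → Y` a morphism of proper models of `K/k`,
  SANDᴸ applied to `M` with `O := φ⁻¹(Reg Y) ∪ Reg M`, `V := φ⁻¹(Reg Y)`, `U := Reg Y` gives a proper model
  `M' → M` regular over `O` (RegLe-ification of one morphism); RegLe-ification twice on the join `M₁ ⋈ M₂` gives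
  two-model patching (Piltant 2013, proof of Prop. 5.1, Step 2). The tree proves both moves for the ALL-FIELDS
  predicates (`Theorems.regLeification_of_sandwichedLocusResolution`,
  `SandwichedGluing.twoModelPatching_of_regLeification`) with bodies that work over one fixed `k`; the
  perfect-field restriction is a re-run of those ~60 lines with `[PerfectField k]` in context (or, better, a
  generalisation of the two tree lemmas to per-field hypotheses, landed `--supports` this item), not an `exact`.
* The assembly `PatchingRelPerfect_of : Sig.stub_sandwichedOfLU → Sig.stub_patchingOfSandwiched →
  PatchingRelPerfect` is PROVED (no `sorry` in its own term): at a prime `p` with the crux's antecedent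
  `hLU : RelLUPerfect p` (verbatim), the two stubs give `TwoModelPatchingPerfect p`, and Zariski's compactness
  (`resPerfect_of_twoModelPatching_of_relLU`, proved from the tree) turns it, with `hLU` again, into
  `ResPerfect p`, the crux's consequent verbatim. `PatchingRelPerfect_proof : PatchingRelPerfect` plugs the two
  `stub_*` in (its only `sorry`s are the two stubs); `shadowGame_PatchingRelPerfect_of` is the same composition
  concluding the `ShadowGame` copy of the decl (the other five copies are the same term too; not imported here).

Consistency (all PROVED below): both stub statements are consequences of the summit restricted to perfect
fields (`sandwichedLocusPerfect_of_resPerfect`, `twoModelPatchingPerfect_of_resPerfect`: resolve `M`, resp. the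
join), so neither can be refuted short of refuting resolution over some perfect field; both are implied by the
all-fields atoms of crux `PatchingRel` (`sandwichedLocusPerfect_of_sandwichedLocusResolution`,
`twoModelPatchingPerfect_of_twoModelPatching`), so any proof landed for stmt-0642's atom closes `stub_sandwichedOfLU`.

Alternatives considered and NOT typed: (a) `TwoModelPatchingPerfect` itself as the only open stub — its
complement is entirely in the tree per field, leaving ONE stub (BC3 wants ≥ 2 genuine ones) or a bookkeeping
second stub; (b) the strong atom SAND⁺ (`SandwichedStrongResolution`, iso over `Reg`) + Nagata + open gluing —
strictly stronger than needed (the gen-0 cut of `sandwiched-gluing`, superseded there by SANDᴸ); (c) a split of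
the atom by dimension (`≤ 3` is the named fact `CossartPiltant2019`, in tree as
`sandwichedLocusResolutionDimLe_three_of_cossartPiltant`; `> 3` is the open residue) — a regime split whose known
half is a vendored fact, not a lemma to prove.

Disproof used: none on file for this crux (`ledger crux ls stmt-ResolutionOfSingularities-16161`: no workfiles
before this one, 2026-08-17); the twin's `Cruxes/PatchingRel/Disproof.lean` and `Theorems/PatchingRel/Negative/*`
concern the all-fields statement's typing (R.FG needed, Nagata load-bearing for the gen-0 cut, integrality
slack) — the stubs here keep `R.FG`, use no compactification, and ask `IsIntegral N`; `ledger negatives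
--problem ResolutionOfSingularities` (1 entry, DefectlessFrames 19085, unrelated) consulted.
-/

noncomputable section

-- single-problem summit: the doubled namespace component `ResolutionOfSingularities` is forced
set_option linter.dupNamespace false

open CategoryTheory AlgebraicGeometry Literature.AlgebraicGeometry.Resolution
open Summit.ResolutionOfSingularities.ResolutionOfSingularities.Theses.FoliationDescent (PatchingRelPerfect)

namespace Summit.ResolutionOfSingularities.ResolutionOfSingularities.Cruxes.PatchingRelPerfect.Lines.Birth

/-! ## The predicates of the cut (universe `0`, as in the crux) -/

/-- **Relative local uniformization in characteristic `p` over PERFECT ground fields** — the ANTECEDENT of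
the crux `PatchingRelPerfect` at the prime `p`, verbatim: for `k` perfect of characteristic `p`, `K/k`
finitely generated, `O` a valuation ring of `K` containing `k` and `R ⊆ O` a finitely generated `k`-algebra,
some finitely generated `A` with `R ⊆ A ⊆ O`, `Frac A = K`, regular at the centre of `O`.
[cite: Piltant2013, Cor. 5.7 (shape of relative LU)] -/
def RelLUPerfect (p : ℕ) : Prop :=
  ∀ (k K : Type) [Field k] [CharP k p] [PerfectField k] [Field K] [Algebra k K],
    (⊤ : IntermediateField k K).FG → ∀ O : ValuationSubring K, (∀ c : k, algebraMap k K c ∈ O) →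
      ∀ R : Subalgebra k K, R.FG → R.toSubring ≤ O.toSubring →
        ∃ (A : Subalgebra k K) (h : A.toSubring ≤ O.toSubring), R ≤ A ∧ A.FG ∧
          IsFractionRing A K ∧ IsRegularLocalRing (Localization.AtPrime
            (Ideal.comap (Subring.inclusion h) (IsLocalRing.maximalIdeal O)))

/-- **Resolution of singularities over PERFECT fields of characteristic `p`** — the CONSEQUENT of the crux at
`p`, verbatim: every reduced separated scheme of finite type over a perfect field of characteristic `p` has a
resolution (`ResolutionInChar p` restricted to perfect ground fields). [cite: Kollar2007, Ch. 3 (the problem)] -/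
def ResPerfect (p : ℕ) : Prop :=
  ∀ (k : Type) [Field k] [CharP k p] [PerfectField k] (X : Scheme.{0}) (f : X ⟶ Spec (.of k)),
    IsSeparated f → LocallyOfFiniteType f → QuasiCompact f → IsReduced X → Scheme.HasResolution X

/-- **Two-model patching of proper models over PERFECT fields of characteristic `p`** (Piltant 2013,
Prop. 5.1 with `P = P_reg`, proper models, no normality): `ProperModel.TwoModelPatching p` restricted to perfect
ground fields — for `k` perfect of characteristic `p`, `K/k` essentially of finite type and proper models
`M₁, M₂` of `K/k`, a proper model `N` with morphisms `φᵢ : N → Mᵢ`, `φᵢ⁻¹(Reg Mᵢ) ⊆ Reg N`. Open in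
transcendence degree `≥ 4`. [cite: Piltant2013, Prop. 5.1 and p. 2] -/
def TwoModelPatchingPerfect (p : ℕ) : Prop :=
  ∀ (k : Type) [Field k] [CharP k p] [PerfectField k] (K : Type) [Field K] [Algebra k K]
    [Algebra.EssFiniteType k K], ∀ M₁ M₂ : ProperModel k K,
      ∃ (N : ProperModel k K) (φ₁ : N.Hom M₁) (φ₂ : N.Hom M₂), φ₁.RegLe ∧ φ₂.RegLe

/-- **SANDᴸ over PERFECT fields of characteristic `p`** — resolution over a sandwiched-singularity open: the
tree's conjecture `SandwichedLocusResolution p` (`Theorems/SandwichedSingularitiesResolution.lean`) restricted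
to perfect ground fields. For `k` perfect of characteristic `p`, `U` a regular integral separated finite-type
`k`-scheme, `M` an integral separated finite-type `k`-scheme, opens `V ⊆ O ⊆ M` with `M` regular on `O ∖ V`,
and a proper birational `k`-morphism `η : V → U`, there is an integral `N` and a proper birational `ρ : N → M`
regular over `O`. Dimension `≤ 3`: Cossart–Piltant 2019; OPEN in dimension `≥ 4` (Piltant 2013, p. 2).
[cite: Piltant2013, p. 2; CossartPiltant2019, Thm. 1.1 (dim ≤ 3)] -/
def SandwichedLocusPerfect (p : ℕ) : Prop :=
  ∀ (k : Type) [Field k] [CharP k p] [PerfectField k] (U M : Scheme.{0}) (f : U ⟶ Spec (.of k))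
    (g : M ⟶ Spec (.of k)) (O V : M.Opens) (η : (V : Scheme.{0}) ⟶ U),
    IsSeparated f → LocallyOfFiniteType f → QuasiCompact f → IsIntegral U →
    Scheme.IsRegular U → IsSeparated g → LocallyOfFiniteType g → QuasiCompact g →
    IsIntegral M → IsProper η → IsBirational η → η ≫ f = V.ι ≫ g → V ≤ O →
    (∀ x : M, x ∈ O → x ∉ V → IsRegularLocalRing (M.presheaf.stalk x)) →
      ∃ (N : Scheme.{0}) (ρ : N ⟶ M), IsIntegral N ∧ IsProper ρ ∧ IsBirational ρ ∧
        ∀ n : N, ρ n ∈ O → IsRegularLocalRing (N.presheaf.stalk n)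

/-! ## Sanity (proved): the predicates are the crux's pieces and compute as intended -/

/-- The crux is literally `∀ p prime, RelLUPerfect p → ResPerfect p`. [folklore] -/
theorem patchingRelPerfect_iff :
    PatchingRelPerfect ↔ ∀ p : ℕ, p.Prime → RelLUPerfect p → ResPerfect p :=
  Iff.rfl

/-- The `ShadowGame` copy of the crux (the first route to file it) is the same term. [folklore] -/
theorem shadowGame_patchingRelPerfect_iff :
    Summit.ResolutionOfSingularities.ResolutionOfSingularities.Theses.ShadowGame.PatchingRelPerfect ↔
      PatchingRelPerfect :=
  Iff.rfl

/-- Resolution in characteristic `p` (all fields) restricts to perfect fields. [folklore] -/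
theorem resPerfect_of_resolutionInChar {p : ℕ} (h : ResolutionInChar.{0} p) : ResPerfect p :=
  fun k _ _ _ X f hs hl hq hr => h k X f hs hl hq hr

/-- The all-fields atom SANDᴸ(p) of crux `PatchingRel` (stmt-0642) gives the perfect-field atom: any proof
landed for `SandwichedLocusResolution p` closes `stub_sandwichedOfLU` outright. [folklore] -/
theorem sandwichedLocusPerfect_of_sandwichedLocusResolution {p : ℕ}
    (h : SandwichedLocusResolution.{0} p) : SandwichedLocusPerfect p :=
  fun k _ _ _ => h k

/-- The all-fields two-model patching `ProperModel.TwoModelPatching p` gives the perfect-field one. [folklore] -/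
theorem twoModelPatchingPerfect_of_twoModelPatching {p : ℕ}
    (h : ProperModel.TwoModelPatching.{0} p) : TwoModelPatchingPerfect p :=
  fun k _ _ _ K _ _ _ => h k K

/-- **No slack for the atom**: resolution over perfect fields gives SANDᴸ over perfect fields (resolve the
integral separated finite-type `k`-scheme `M` itself; a resolution is a resolution over every open). Hence
`stub_sandwichedOfLU` is implied by the crux's own conclusion and cannot be refuted short of refuting
resolution over some perfect field of characteristic `p`. [folklore] -/
theorem sandwichedLocusPerfect_of_resPerfect {p : ℕ} (h : ResPerfect p) : SandwichedLocusPerfect p :=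
  fun k _ _ _ _ M _ g O _ _ _ _ _ _ _ hg₁ hg₂ hg₃ _ _ _ _ _ _ =>
    Theorems.exists_of_hasResolution (h k M g hg₁ hg₂ hg₃ inferInstance) O

/-- **No slack for the patching stub**: resolution over perfect fields gives two-model patching over perfect
fields (resolve the join `M₁ ⋈ M₂`; a regular model is `RegLe` over every model it dominates). [folklore] -/
theorem twoModelPatchingPerfect_of_resPerfect {p : ℕ} (h : ResPerfect p) : TwoModelPatchingPerfect p := by
  intro k _ _ _ K _ _ _ M₁ M₂
  obtain ⟨N, φ, hN⟩ := (ProperModel.join M₁ M₂).exists_hom_isRegular_of_hasResolution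
    (h k (ProperModel.join M₁ M₂).X (ProperModel.join M₁ M₂).π inferInstance inferInstance
      inferInstance inferInstance)
  exact ⟨N, φ.comp (ProperModel.joinFst M₁ M₂), φ.comp (ProperModel.joinSnd M₁ M₂),
    fun y _ => hN y, fun y _ => hN y⟩

/-! ## Zariski's compactness step, PROVED fibrewise over a perfect field (not a stub) -/

/-- **Resolution over perfect fields of characteristic `p` from two-model patching and relative LU over
perfect fields** (Zariski 1944 / Piltant 2013, Cor. 5.7, with proper models, in every dimension): for `k`
perfect of characteristic `p`, relative LU over `k` gives every valuation a proper model with regular centre,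
quasi-compactness of the Zariski–Riemann space a finite resolving system, two-model patching over `k` one
regular model, and components + Chow + projective closure the general reduced separated finite-type case —
all fibrewise theorems of the tree (`resolutionOverUpToDim_of_properPatching_of_relLU`), instantiated at the
perfect field `k` with the LU hypothesis reshaped as in `resolutionInChar_of_properTwoModelPatching_of_relLU`.
[cite: Piltant2013, Prop. 5.1 and Cor. 5.7] -/
theorem resPerfect_of_twoModelPatching_of_relLU {p : ℕ} (hZ : TwoModelPatchingPerfect p)
    (hLU : RelLUPerfect p) : ResPerfect p := by
  intro k _ _ _ X f hs hl hq hr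
  haveI : QuasiCompact f := hq
  haveI : LocallyOfFiniteType f := hl
  haveI : CompactSpace X := QuasiCompact.compactSpace_of_compactSpace f
  obtain ⟨d, hd⟩ := exists_topologicalKrullDim_le_of_locallyOfFiniteType f
  have hLU' : ∀ (K : Type) [Field K] [Algebra k K] (O : ValuationSubring K) (R : Subalgebra k K),
      R.FG → IsFractionRing R K → R.toSubring ≤ O.toSubring →
        ∃ (A : Subalgebra k K) (h : A.toSubring ≤ O.toSubring), R ≤ A ∧ A.FG ∧
          IsRegularLocalRing (Localization.AtPrime
            (Ideal.comap (Subring.inclusion h) (IsLocalRing.maximalIdeal O))) := by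
    intro K _ _ O R hRfg hRfr hRO
    haveI : Algebra.FiniteType k R := R.fg_iff_finiteType.mp hRfg
    haveI : Algebra.EssFiniteType R K :=
      Algebra.EssFiniteType.of_isLocalization K (nonZeroDivisors R)
    have hKfg : (⊤ : IntermediateField k K).FG :=
      IntermediateField.fg_top_iff.mpr (Algebra.EssFiniteType.comp k R K)
    obtain ⟨A, h, hle, hAfg, -, hreg⟩ :=
      hLU k K hKfg O (fun c => hRO (R.algebraMap_mem c)) R hRfg hRO
    exact ⟨A, h, hle, hAfg, hreg⟩
  have hZ' : ∀ (K : Type) [Field K] [Algebra k K] [Algebra.EssFiniteType k K],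
      ∀ M₁ M₂ : ProperModel k K,
        ∃ (N : ProperModel k K) (φ₁ : N.Hom M₁) (φ₂ : N.Hom M₂), φ₁.RegLe ∧ φ₂.RegLe :=
    fun K _ _ _ => hZ k K
  exact resolutionOverUpToDim_of_properPatching_of_relLU hZ' hLU' d X f hs hl hq hr hd

/-! ## The two stub STATEMENTS by name (`Sig.stub_<name>`; `PatchingRelPerfect_of` takes exactly these) -/

/-- Statement of `stub_sandwichedOfLU` (the atom): relative LU over perfect fields of characteristic `p` ⇒
SANDᴸ over perfect fields of characteristic `p`, prime by prime. [cite: Piltant2013, p. 2] -/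
def Sig.stub_sandwichedOfLU : Prop :=
  ∀ p : ℕ, p.Prime → RelLUPerfect p → SandwichedLocusPerfect p

/-- Statement of `stub_patchingOfSandwiched`: SANDᴸ over perfect fields ⇒ two-model patching of proper models
over perfect fields (RegLe-ification of one morphism from SANDᴸ, twice on the join).
[cite: Piltant2013, Prop. 5.1 (proof, Step 2)] -/
def Sig.stub_patchingOfSandwiched : Prop :=
  ∀ p : ℕ, p.Prime → SandwichedLocusPerfect p → TwoModelPatchingPerfect p

/-- The crux implies the atom's statement (no slack: `PatchingRelPerfect ⟺ Sig.stub_sandwichedOfLU` modulo the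
TRUE stub `Sig.stub_patchingOfSandwiched`, cf. `PatchingRelPerfect_of`). [folklore] -/
theorem sig_stub_sandwichedOfLU_of_crux (h : PatchingRelPerfect) : Sig.stub_sandwichedOfLU :=
  fun p hp hLU => sandwichedLocusPerfect_of_resPerfect (h p hp hLU)

/-- The summit implies the patching stub's statement outright. [folklore] -/
theorem sig_stub_patchingOfSandwiched_of_summit (h : _root_.ResolutionOfSingularities) :
    Sig.stub_patchingOfSandwiched :=
  fun p hp _ => twoModelPatchingPerfect_of_resPerfect (resPerfect_of_resolutionInChar (h p hp))

/-! ## The stubs -/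

/-- **STUB (load-bearing; OPEN in dimension ≥ 4, Cossart–Piltant 2019 in dimension ≤ 3).** The atom: relative
local uniformization over perfect fields of characteristic `p` gives resolution over sandwiched-singularity
opens over perfect fields of characteristic `p`. See the module docstring.
[cite: Piltant2013, p. 2; CossartPiltant2019, Thm. 1.1] -/
theorem stub_sandwichedOfLU (p : ℕ) (hp : p.Prime) (hLU : RelLUPerfect p) :
    SandwichedLocusPerfect p := by
  sorry

/-- **STUB (TRUE on paper, Lean size M: per-perfect-field re-run of
`Theorems.regLeification_of_sandwichedLocusResolution` and `SandwichedGluing.twoModelPatching_of_regLeification`).**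
SANDᴸ over perfect fields gives two-model patching of proper models over perfect fields. See the module
docstring. [cite: Piltant2013, Prop. 5.1 (proof, Step 2)] -/
theorem stub_patchingOfSandwiched (p : ℕ) (hp : p.Prime) (hS : SandwichedLocusPerfect p) :
    TwoModelPatchingPerfect p := by
  sorry

/-! ## The composition (kernel-checked; no `sorry` in its own term) -/

/-- **`PatchingRelPerfect` from the two stub statements** — the assembly, PROVED: at a prime `p`, with the
crux's antecedent `hLU : RelLUPerfect p` (verbatim), the atom gives SANDᴸ over perfect fields, the patching stub
turns it into two-model patching over perfect fields, and Zariski's compactness step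
(`resPerfect_of_twoModelPatching_of_relLU`, proved above from the tree) turns that, with `hLU` again, into
`ResPerfect p`, the crux's consequent verbatim. [cite: Piltant2013, Cor. 5.7] -/
theorem PatchingRelPerfect_of :
    Sig.stub_sandwichedOfLU → Sig.stub_patchingOfSandwiched → PatchingRelPerfect :=
  fun h₁ h₂ p hp hLU => resPerfect_of_twoModelPatching_of_relLU (h₂ p hp (h₁ p hp hLU)) hLU

/-- **The crux `PatchingRelPerfect`, assembled from the two registered stubs** (the skeleton in its final
shape: `PatchingRelPerfect_of` with the `stub_*` plugged in; the only `sorry`s in its closure are the two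
stubs, none of its own). -/
theorem PatchingRelPerfect_proof : PatchingRelPerfect :=
  PatchingRelPerfect_of stub_sandwichedOfLU stub_patchingOfSandwiched

/-- The same skeleton concludes the `ShadowGame` copy of the shared crux (same term; likewise for the
`WildCones`, `FrobeniusClosing`, `InertialGeneration`, `DefectlessFrames`, `JacobianBudget` copies). -/
theorem shadowGame_PatchingRelPerfect_of :
    Sig.stub_sandwichedOfLU → Sig.stub_patchingOfSandwiched →
      Summit.ResolutionOfSingularities.ResolutionOfSingularities.Theses.ShadowGame.PatchingRelPerfect :=
  PatchingRelPerfect_of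

end Summit.ResolutionOfSingularities.ResolutionOfSingularities.Cruxes.PatchingRelPerfect.Lines.Birth

end
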